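import Mathlib
import HarnessLib
import Summits.HubbardSuperconductivity.HubbardSuperconductivity.Theorems.KLProgrammeFermiSurfaceSharpTransversal

/-!
# Route `KLProgramme` (K3 `KLRegimeTwoPointLimit` and its five children) — risk-register item r2: the SHARP `BandBounds`
# bundle with Lean-certified NUMBERS on the COVARIANCE WINDOW `μ ∈ [-1.05, -0.15]` (`klWindowC`)

Cell `gate-hubbard-kl`, seat fs-1 (g6). The five K3 children are stated on `klWindowC = Icc (-1.05) (-0.15)`
(`KLProgrammeKLRegimeSplitOnWindow.lean`: the Hartree-shifted level `μ - U/2` of the analysis window `[-1, -0.15]`); p2's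
`covWindow_geomConstants` serves FST II's `GeomConstants` there, but no numeric `BandBounds` bundle existed on that range (the
analysis-window bundle `klfs_analysisWindow_sharpBandBounds_exactDt` stops at `a = -1`). This file is the `a = -1.05` edition of
`KLProgrammeFermiSurfaceSharpAnalysisWindow.lean` + the exact transversality constant of `…SharpTransversal.lean`: numeric
corollaries of `klfs_exists_sharpBandBounds` at `a = -1.05`, `b = -0.15`. The transcendental inputs are `d_a = arccos(0.2625) ≥ 1.305`
(from `cos 1.305 = sin(π/2 - 1.305) > 0.2626`), `sin d_a = √(1 - 0.2625²) ≤ 0.96494`, and the analysis-window facts at `b = -0.15`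
(`K_b ≤ 2.76`, `κ_b ≥ 0.02653`). Result (`klfs_covWindow_sharpBandBounds`): a `BandBounds (-1.05) (-0.15)` with
  `umin ≥ 1.845`, `smax ≤ 3.91`, `A2 ≤ 36.2`, `hmin ≥ 0.1369`, `amin ≥ 0.0489`, `rhomin ≥ 0.3799`, `cmax ≤ 0.7395`,
  `Dtmin ≥ 0.7599` (`= 2 s_b`, exact), **`C_g ≤ 165`**, `Dcell ≤ 3.28`
(certified sharp values, kit j256230, two interval implementations, FS-WINDOW.md §8b: `1.8458`, `3.8917`, `35.968`, `0.13703`,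
`0.048979`, `0.37997`, `0.73931`, `0.75993`, `164.23`, `3.262`; the tree's generic `bandBounds (-1.05) (-0.15)`: `C_g = 172 650`,
`A2 = 1284`, `smax = 19.5`, `hmin = 0.0515`, `Dcell = 11.85`). Also `∂ₜF ≥ 0.7599` on the covariance window
(`klfs_covWindow_rayDispersionDt_ge`). No definitions; everything PROVED. [folklore]
-/

noncomputable section

open Real Set

-- the tree's namespace `Summit.<Summit>.<Problem>.Theorems` repeats the summit name by design (D-0017)
set_option linter.dupNamespace false

namespace Summit.HubbardSuperconductivity.HubbardSuperconductivity.Theorems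

open Literature.MathematicalPhysics.QuantumLattice
open Literature.MathematicalPhysics.QuantumLattice.BandSectorCounting

/-! ### §1 The numeric inputs at `a = -1.05` -/

/-- **`d_a = arccos(0.2625) ≥ 1.305`** (`cos 1.305 = sin(π/2 - 1.305) > 0.2626 > 0.2625`). [folklore] -/
theorem klfs_numC_arccos_da_ge : (1.305 : ℝ) ≤ Real.arccos (-(-1.05 : ℝ) / 4) := by
  have hπ1 := Real.pi_gt_d6
  have hπ2 := Real.pi_lt_d6
  set x : ℝ := π / 2 - 1.305 with hx
  have hx1 : (0.265796 : ℝ) ≤ x := by rw [hx]; linarith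
  have hx2 : x ≤ (0.265797 : ℝ) := by rw [hx]; linarith
  have hx0 : 0 < x := by linarith
  have hsin : x - x ^ 3 / 6 < Real.sin x := Real.sin_gt_sub_cube hx0
  have hx3 : x ^ 3 ≤ (0.265797 : ℝ) ^ 3 := pow_le_pow_left₀ hx0.le hx2 3
  have hcos : Real.cos 1.305 = Real.sin x := by rw [hx, Real.sin_pi_div_two_sub]
  have hval : (-(-1.05 : ℝ) / 4) ≤ Real.cos 1.305 := by rw [hcos]; norm_num at hx3 ⊢; linarith
  have h := Real.antitone_arccos hval
  rwa [Real.arccos_cos (by norm_num) (by linarith)] at h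

/-- `d_a ≤ π/2 < 1.5708`. [folklore] -/
theorem klfs_numC_arccos_da_le : Real.arccos (-(-1.05 : ℝ) / 4) ≤ 1.5708 := by
  have h := Real.arccos_lt_pi_div_two.2 (show (0 : ℝ) < -(-1.05 : ℝ) / 4 by norm_num)
  have hπ2 := Real.pi_lt_d6
  linarith

/-- **`sin d_a = √(1 - 0.2625²) ≤ 0.96494`**. [folklore] -/
theorem klfs_numC_sin_da_le : Real.sin (Real.arccos (-(-1.05 : ℝ) / 4)) ≤ 0.96494 := by
  rw [Real.sin_arccos, Real.sqrt_le_left (by norm_num)]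
  norm_num

/-- `0.3799 ≤ s_* = min(s_a, s_b) ≤ s_b ≤ 0.38` on the covariance window (`s_a = √(1.05·2.95)/2 ≈ 0.88`, `s_b = √0.5775/2`). [folklore] -/
theorem klfs_numC_levelSin_min :
    (0.3799 : ℝ) ≤ min (Real.sqrt (-(-1.05 : ℝ) * (4 + -1.05)) / 2) (Real.sqrt (-(-0.15 : ℝ) * (4 + -0.15)) / 2) ∧
    min (Real.sqrt (-(-1.05 : ℝ) * (4 + -1.05)) / 2) (Real.sqrt (-(-0.15 : ℝ) * (4 + -0.15)) / 2) ≤ 0.38 := by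
  have ha : (0.879 : ℝ) ≤ Real.sqrt (-(-1.05 : ℝ) * (4 + -1.05)) / 2 := by
    rw [le_div_iff₀ (by norm_num : (0:ℝ) < 2), Real.le_sqrt (by norm_num) (by norm_num)]; norm_num
  have hb : (0.3799 : ℝ) ≤ Real.sqrt (-(-0.15 : ℝ) * (4 + -0.15)) / 2 := by
    rw [le_div_iff₀ (by norm_num : (0:ℝ) < 2), Real.le_sqrt (by norm_num) (by norm_num)]; norm_num
  have hb' : Real.sqrt (-(-0.15 : ℝ) * (4 + -0.15)) / 2 ≤ 0.38 := by
    rw [div_le_iff₀ (by norm_num : (0:ℝ) < 2), Real.sqrt_le_left (by norm_num)]; norm_num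
  exact ⟨le_min (by linarith) hb, (min_le_right _ _).trans hb'⟩

/-- `0.07489 ≤ min(n_a, n_b)` (`n_μ = (-μ/2)(1 - μ²/16)`; `n_a = 0.4888`, the minimum is `n_b = 0.074894…`). [folklore] -/
theorem klfs_numC_levelN_min_ge :
    (0.07489 : ℝ) ≤ min (-(-1.05 : ℝ) / 2 * (1 - (-1.05 : ℝ) ^ 2 / 16)) (-(-0.15 : ℝ) / 2 * (1 - (-0.15 : ℝ) ^ 2 / 16)) :=
  le_min (by norm_num) (by norm_num)

/-- `sin d_a / d_a ≤ 0.96494/1.305 < 0.7395`. [folklore] -/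
theorem klfs_numC_sinc_da_le : Real.sin (Real.arccos (-(-1.05 : ℝ) / 4)) / Real.arccos (-(-1.05 : ℝ) / 4) ≤ 0.7395 := by
  have hd := klfs_numC_arccos_da_ge
  have hd0 : 0 < Real.arccos (-(-1.05 : ℝ) / 4) := by linarith
  rw [div_le_iff₀ hd0]
  have := klfs_numC_sin_da_le
  nlinarith

/-- `0 < sin d_a / d_a`. [folklore] -/
theorem klfs_numC_sinc_da_pos : 0 < Real.sin (Real.arccos (-(-1.05 : ℝ) / 4)) / Real.arccos (-(-1.05 : ℝ) / 4) := by
  have hd := klfs_numC_arccos_da_ge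
  have hdle := klfs_numC_arccos_da_le
  have hd0 : 0 < Real.arccos (-(-1.05 : ℝ) / 4) := by linarith
  exact div_pos (Real.sin_pos_of_pos_of_lt_pi hd0 (by linarith [Real.pi_gt_d6])) hd0

/-- `sin(√2 d) ≥ 0.585` whenever `1.305 ≤ d ≤ 1.5708` (then `π - √2 d ∈ [0.92, 1.30] ⊂ [0, π/2]` and `sin x ≥ (2/π) x`) — the
`d ≥ 1.305` edition of `klfs_num_sin_sqrt_two_mul_ge`. [folklore] -/
theorem klfs_numC_sin_sqrt_two_mul_ge {d : ℝ} (hd1 : 1.305 ≤ d) (hd2 : d ≤ 1.5708) :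
    (0.585 : ℝ) ≤ Real.sin (Real.sqrt 2 * d) := by
  have hπ1 := Real.pi_gt_d6
  have hπ2 := Real.pi_lt_d6
  obtain ⟨h2l, h2u⟩ := klfs_num_sqrt_two
  have hlo : (1.8455 : ℝ) ≤ Real.sqrt 2 * d := by nlinarith
  have hhi : Real.sqrt 2 * d ≤ 2.2215 := by nlinarith
  rw [← Real.sin_pi_sub]
  have hx0 : 0 ≤ π - Real.sqrt 2 * d := by linarith
  have hx1 : π - Real.sqrt 2 * d ≤ π / 2 := by linarith
  have h := Real.mul_le_sin hx0 hx1
  have hπ0 : 0 < π := Real.pi_pos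
  have h3 : (0.585 : ℝ) ≤ 2 / π * (π - Real.sqrt 2 * d) := by
    rw [div_mul_eq_mul_div, le_div_iff₀ hπ0]
    linarith
  linarith

/-! ### §2 Radial transversality and the bundle on the covariance window -/

/-- **`∂ₜF ≥ 0.7599` on the covariance window** `μ ∈ [-1.05, -0.15]` (`= 2 s_b`; `sin(√2 d_a) ≥ 0.585`, `sin K_b = s_b ≥ 0.37995`). [folklore] -/
theorem klfs_covWindow_rayDispersionDt_ge {μ : ℝ} (hμ : μ ∈ Icc (-1.05 : ℝ) (-0.15)) (θ : ℝ) :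
    (0.7599 : ℝ) ≤ rayDispersionDt θ (bandFermiRadius μ θ) := by
  have h := klfs_rayDispersionDt_ge_range (a := -1.05) (b := -0.15) (by norm_num) (by norm_num) (by norm_num) hμ θ
  have hs : (0.37995 : ℝ) ≤ Real.sin (umklappRadius (-0.15)) := by
    rw [klfs_sin_umklappRadius (by norm_num) (by norm_num), le_div_iff₀ (by norm_num : (0:ℝ) < 2),
      Real.le_sqrt (by norm_num) (by norm_num)]
    norm_num
  have hp : (0.585 : ℝ) ≤ Real.sin (Real.sqrt 2 * Real.arccos (-(-1.05 : ℝ) / 4)) :=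
    klfs_numC_sin_sqrt_two_mul_ge klfs_numC_arccos_da_ge klfs_numC_arccos_da_le
  have hmin : (0.37995 : ℝ) ≤ min (Real.sin (Real.sqrt 2 * Real.arccos (-(-1.05 : ℝ) / 4)))
      (Real.sin (umklappRadius (-0.15))) := le_min (by linarith) hs
  linarith

/-- **The SHARP bundle on the covariance window `μ ∈ [-1.05, -0.15]` (`klWindowC` of the K3 children) with its constants as
numbers and the exact transversality constant**: a `BandBounds (-1.05) (-0.15)` with `umin ≥ 1.845`, `smax ≤ 3.91`, `A2 ≤ 36.2`,
`hmin ≥ 0.1369`, `amin ≥ 0.0489`, `rhomin ≥ 0.3799`, `cmax ≤ 0.7395`, `Dtmin ≥ 0.7599`, `C_g ≤ 165`, `Dcell ≤ 3.28`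
(certified sharp values, kit j256230: `1.8458, 3.8917, 35.968, 0.13703, 0.048979, 0.37997, 0.73931, 0.75993, 164.23, 3.262`;
the generic `bandBounds` on the same range: `umin = 1.72`, `smax = 19.5`, `A2 = 1284`, `hmin = 0.0515`, `amin = 1.9·10⁻⁴`,
`rhomin = 0.237`, `cmax = 1.16`, `Dtmin = 0.474`, `C_g = 172 650`, `Dcell = 11.85`). [folklore] -/
theorem klfs_covWindow_sharpBandBounds :
    ∃ B : BandBounds (-1.05) (-0.15),
      1.845 ≤ B.umin ∧ B.smax ≤ 3.91 ∧ B.A2 ≤ 36.2 ∧ 0.1369 ≤ B.hmin ∧ 0.0489 ≤ B.amin ∧ 0.3799 ≤ B.rhomin ∧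
      B.cmax ≤ 0.7395 ∧ 0.7599 ≤ B.Dtmin ∧ B.Cg ≤ 165 ∧ B.Dcell ≤ 3.28 := by
  obtain ⟨B₀, hu, hs, hA, hh, ham, hr, hc, -⟩ :=
    klfs_exists_sharpBandBounds (a := -1.05) (b := -0.15) (by norm_num) (by norm_num) (by norm_num)
  obtain ⟨h2l, h2u⟩ := klfs_num_sqrt_two
  have hd := klfs_numC_arccos_da_ge
  have hK := klfs_numA_umklappRadius_b_le
  have hK0 : 0 < umklappRadius (-0.15) := umklappRadius_pos (by norm_num)
  obtain ⟨hsl, hsu⟩ := klfs_numC_levelSin_min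
  have hκ := klfs_numA_kappa_b_ge
  have hn := klfs_numC_levelN_min_ge
  have hsinc := klfs_numC_sinc_da_le
  have hsinc0 := klfs_numC_sinc_da_pos
  -- the seven fields kept from the closed-form bundle
  have e_umin : 1.845 ≤ B₀.umin := by
    rw [hu]
    calc (1.845 : ℝ) ≤ 1.41421 * 1.305 := by norm_num
      _ ≤ Real.sqrt 2 * Real.arccos (-(-1.05 : ℝ) / 4) := mul_le_mul h2l hd (by norm_num) (Real.sqrt_nonneg 2)
  have e_smax : B₀.smax ≤ 3.91 := by
    rw [hs]
    calc Real.sqrt 2 * umklappRadius (-0.15) ≤ 1.41422 * 2.76 := mul_le_mul h2u hK hK0.le (by norm_num)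
      _ ≤ 3.91 := by norm_num
  have e_A2 : B₀.A2 ≤ 36.2 := by
    rw [hA]
    have h1 : umklappRadius (-0.15) ^ 2 /
        min (Real.sqrt (-(-1.05 : ℝ) * (4 + -1.05)) / 2) (Real.sqrt (-(-0.15 : ℝ) * (4 + -0.15)) / 2) ≤
        2.76 ^ 2 / 0.3799 :=
      (div_le_div_of_nonneg_right (pow_le_pow_left₀ hK0.le hK 2) (by linarith)).trans
        (div_le_div_of_nonneg_left (by norm_num) (by norm_num) hsl)
    have h3 : 0 ≤ umklappRadius (-0.15) ^ 2 /
        min (Real.sqrt (-(-1.05 : ℝ) * (4 + -1.05)) / 2) (Real.sqrt (-(-0.15 : ℝ) * (4 + -0.15)) / 2) +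
        2 * umklappRadius (-0.15) := by positivity
    calc Real.sqrt 2 * (umklappRadius (-0.15) ^ 2 /
          min (Real.sqrt (-(-1.05 : ℝ) * (4 + -1.05)) / 2) (Real.sqrt (-(-0.15 : ℝ) * (4 + -0.15)) / 2) +
          2 * umklappRadius (-0.15))
        ≤ 1.41422 * (2.76 ^ 2 / 0.3799 + 2 * 2.76) := mul_le_mul h2u (by linarith) h3 (by norm_num)
      _ ≤ 36.2 := by norm_num
  have e_hmin : 0.1369 ≤ B₀.hmin := by
    rw [hh, le_div_iff₀ (pow_pos hsinc0 2)]
    have h1 : (Real.sin (Real.arccos (-(-1.05 : ℝ) / 4)) / Real.arccos (-(-1.05 : ℝ) / 4)) ^ 2 ≤ 0.7395 ^ 2 :=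
      pow_le_pow_left₀ hsinc0.le hsinc 2
    calc (0.1369 : ℝ) * (Real.sin (Real.arccos (-(-1.05 : ℝ) / 4)) / Real.arccos (-(-1.05 : ℝ) / 4)) ^ 2
        ≤ 0.1369 * 0.7395 ^ 2 := mul_le_mul_of_nonneg_left h1 (by norm_num)
      _ ≤ 0.07489 := by norm_num
      _ ≤ _ := hn
  have e_amin : 0.0489 ≤ B₀.amin := by
    rw [ham]
    calc (0.0489 : ℝ) ≤ 0.02653 * (1.41421 * 1.305) := by norm_num
      _ ≤ _ := mul_le_mul hκ (mul_le_mul h2l hd (by norm_num) (Real.sqrt_nonneg 2)) (by norm_num) (by linarith)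
  have e_rhomin : 0.3799 ≤ B₀.rhomin := by rw [hr]; exact hsl
  have e_cmax : B₀.cmax ≤ 0.7395 := by rw [hc]; exact hsinc
  -- the exact transversality constant replaces the closed-form `Dtmin`
  have hDt : ∀ μ ∈ Icc (-1.05 : ℝ) (-0.15), ∀ θ : ℝ, (0.7599 : ℝ) ≤ rayDispersionDt θ (bandFermiRadius μ θ) :=
    fun μ hμ θ => klfs_covWindow_rayDispersionDt_ge hμ θ
  refine ⟨{ B₀ with Dtmin := 0.7599, Dtmin_pos := by norm_num, Dt_ge := hDt }, e_umin, e_smax, e_A2, e_hmin, e_amin,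
    e_rhomin, e_cmax, le_rfl, ?_, ?_⟩
  · show π * B₀.cmax / (2 * B₀.amin * B₀.rhomin ^ 2) ≤ 165
    have hπ := Real.pi_lt_d4
    have hBa : 0 < B₀.amin := B₀.amin_pos
    have hBr : 0 < B₀.rhomin := B₀.rhomin_pos
    rw [div_le_iff₀ (by positivity)]
    have h1 : π * B₀.cmax ≤ 3.1416 * 0.7395 := mul_le_mul hπ.le e_cmax B₀.cmax_pos.le (by norm_num)
    have h2 : (0.0489 : ℝ) * 0.3799 ^ 2 ≤ B₀.amin * B₀.rhomin ^ 2 :=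
      mul_le_mul e_amin (pow_le_pow_left₀ (by norm_num) e_rhomin 2) (by norm_num) hBa.le
    have h3 : 165 * (2 * B₀.amin * B₀.rhomin ^ 2) = 330 * (B₀.amin * B₀.rhomin ^ 2) := by ring
    rw [h3]
    linarith
  · show 1 / (0.7599 : ℝ) + B₀.smax / 2 ≤ 3.28
    have : (1 : ℝ) / 0.7599 ≤ 1.316 := by norm_num
    linarith

end Summit.HubbardSuperconductivity.HubbardSuperconductivity.Theorems

end
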